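import Literature.AlgebraicGeometry.Motives.FrobeniusTraceProofs
import Literature.AlgebraicGeometry.Motives.FrobeniusDeterminantWeights
import Literature.AlgebraicGeometry.Motives.AbelianVarietyPointCountIsogenyInvariance
import Literature.AlgebraicGeometry.Motives.CorrespondencesKunneth
import Mathlib.LinearAlgebra.Trace
import HarnessLib

/-!
# `Z(X ×ₖ Y, T)` is computed by the Künneth cohomology `⊕_{i+j=κ} Hⁱ(X) ⊗ Hʲ(Y)` from the trace formula
# alone, WITHOUT a Künneth axiom; the Euler characteristic is multiplicative unconditionally

Topic `Literature/AlgebraicGeometry/Motives`; THEOREMS ONLY (no definition, no instance, no named fact;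
D-0026).  For a Galois Weil cohomology theory `E` over a finite field satisfying the Lefschetz trace formula,
the tree's `zetaSeries_mul_prod_frobCharPoly_holds` gives Deligne's (1.5.4)
`Z(X, T) ∏_{i even} det(1 − T·F | Hⁱ(X)) = ∏_{i odd} det(1 − T·F | Hⁱ(X))`.  The structure `GaloisWeilCohomology`
carries NO Künneth axiom (Kahn §3.6 (vi)); nevertheless the product formula for point counts
`#(X × Y)(𝔽_{q^m}) = #X(𝔽_{q^m}) #Y(𝔽_{q^m})` and `tr((F ⊗ F)ᵐ) = tr(Fᵐ) tr(Fᵐ)` give (1.5.4) for `X ×ₖ Y` with the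
"Künneth cohomology" `⊕_{i+j=κ} Hⁱ(X) ⊗_K Hʲ(Y)` and the endomorphisms `Fᵢ ⊗ Fⱼ` in place of `H^κ(X × Y)`, `F`
— Ramachandran's second proof of `Z(X × Y) = Z(X) ∗ Z(Y)` run backwards.  Comparing with (1.5.4) for
`H^*(X ×ₖ Y)` itself yields `e(X ×ₖ Y) = e(X) e(Y)` for the `E`-Betti numbers WITHOUT the Riemann hypothesis
(the tree's `eulerChar_tensor_eq_mul`, row g44-#7, assumed it for `X`, `Y` and `X ×ₖ Y`).

## Sources, verbatim

N. Ramachandran, *Zeta functions, Grothendieck groups, and the Witt ring*, Bull. Sci. Math. 139 (2015)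
[Ramachandran2014], Theorem 2.1 (i) «`Z(X × Y, t) = Z(X, t) ∗ Z(Y, t) ∈ W(ℤ)`», second proof: «based on
Künneth theorem and the cohomological interpretation of the zeta function; recall
`Z(X,t) = ∏ᵢ det(1 − F*t, Hⁱ_c(X̄, ℚ_ℓ))^{(−1)^{i+1}}` … By the Künneth theorem, any `α_{X×Y}` is a product of a
`α_X` and a `α_Y`», §1 «If `φ : U → U` is an endomorphism of a finite-dimensional vector space `U`, then the ghost
components of `Q(t) = det(1 − tφ | U)⁻¹` are given by `gh_n(Q) = Trace(φⁿ | U)`», Remark 2.4.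
P. Deligne, *La conjecture de Weil. I* [Deligne1974], (1.5.1)–(1.5.4).
B. Kahn, *Zeta and L-functions of varieties and motives* [Kahn2020], §3.6 axiom (vi) (Künneth formula
`H*(X) ⊗ H*(Y) ⥲ H*(X × Y)`), (3.6.3) `bᵢ = deg Pᵢ`.
L. Göttsche, *Hilbert schemes of zero-dimensional subschemes* [Gottsche1993], §1.2 p. 6 (`p(X × Y, z) =
p(X, z) p(Y, z)`, `e = p(−1)`), Theorem 1.2.1 (4).

## What is here

For `E` with the Lefschetz trace formula, `X` smooth projective of dimension `n`, `Y` of dimension `n'`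
(`Fᵢ = F | Hⁱ(X)`, `Fⱼ' = F | Hʲ(Y)`, `bᵢ = dim Hⁱ`):
* §1 `tr((Fᵢ ⊗ Fⱼ')ᵐ) = tr(Fᵢᵐ) tr(Fⱼ'ᵐ)`; `exp(Σ_m tr((Fᵢ ⊗ Fⱼ')ᵐ) Tᵐ/m) · det(1 − T·Fᵢ ⊗ Fⱼ') = 1`;
  `deg det(1 − T·Fᵢ ⊗ Fⱼ') = bᵢ bⱼ` (`Fᵢ ⊗ Fⱼ'` is invertible).
* §2 **`zetaSeries_tensor_mul_prod_charpoly_tensor`**: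
  `Z(X ×ₖ Y, T) · ∏_{i+j even} det(1 − T·Fᵢ ⊗ Fⱼ') = ∏_{i+j odd} det(1 − T·Fᵢ ⊗ Fⱼ')` in `K⟦T⟧` (products over
  `0 ≤ i ≤ 2n`, `0 ≤ j ≤ 2n'`) — no hypothesis on `X ×ₖ Y` at all.
* §3 **`sum_neg_one_pow_mul_finrank_tensor_eq_mul`**: `Σ_{κ ≤ 2(n+n')} (−1)^κ b_κ(X ×ₖ Y) =
  (Σᵢ (−1)ⁱ bᵢ(X)) (Σⱼ (−1)ʲ bⱼ(Y))` — `e(X × Y) = e(X) e(Y)` from the trace formula ALONE (compare degrees of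
  the two expressions of `Z(X ×ₖ Y)` as a quotient of polynomials).

HC is not touched.

## References

* [Ramachandran2014] N. Ramachandran, *Zeta functions, Grothendieck groups, and the Witt ring*, Bull. Sci.
  Math. 139 (2015) 599–627 (arXiv:1407.1813), Theorem 2.1 (i) (second proof), §1, Remark 2.4.
* [Deligne1974] P. Deligne, *La conjecture de Weil. I*, Publ. Math. IHÉS 43 (1974), (1.5.1)–(1.5.4).
* [Kahn2020] B. Kahn, *Zeta and L-Functions of Varieties and Motives*, LMS LN 462 (2020), §3.6 (vi), (3.6.3).
* [Gottsche1993] L. Göttsche, LNM 1572, §1.2 p. 6, Theorem 1.2.1 (4).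
* Tree: `FrobeniusTraceProofs` (`FrobeniusTrace.exp_subst_endTraceLogSeries_mul_reverse_charpoly`,
  `…exp_subst_add/sum/mul_exp_subst_neg`, `zetaSeries_mul_prod_frobCharPoly_holds`),
  `FrobeniusDeterminantWeights` (`natDegree_frobCharPoly_eq`), `AbelianVarietyPointCountIsogenyInvariance`
  (`pointCount_tensorObj`), `CorrespondencesKunneth` (`isSmoothProjective_tensor`).

## Provenance

Lane `lit-hodgefound` (summit `HodgeConjecture`, Track 2 foundations library, Layer B: motives / zeta functions —
the zeta function of a product `Z(X × Y) = Z(X) ∗ Z(Y)`), seat `lit-hodgefound-p29` (literature-prover,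
generation 45, row g45-#4).
-/

universe u v

open PowerSeries TensorProduct
open scoped Polynomial

noncomputable section

namespace Literature.AlgebraicGeometry.Motives

/-! ### §1 Linear algebra of `F ⊗ F'` -/

namespace FrobeniusTrace

variable {R : Type*} [Field R] [CharZero R] {M N : Type*} [AddCommGroup M] [Module R M]
  [AddCommGroup N] [Module R N] [Module.Finite R M] [Module.Finite R N]

omit [CharZero R] in
/-- **`tr((f ⊗ g)ᵐ) = tr(fᵐ) · tr(gᵐ)`** (`(f ⊗ g)ᵐ = fᵐ ⊗ gᵐ` and the trace is multiplicative on tensor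
products; the identity behind «any `α_{X×Y}` is a product of a `α_X` and a `α_Y`»).
[cite: Ramachandran2014, Theorem 2.1 (i) (second proof)] -/
theorem trace_map_pow (f : M →ₗ[R] M) (g : N →ₗ[R] N) (m : ℕ) :
    LinearMap.trace R (M ⊗[R] N) (TensorProduct.map f g ^ m) =
      LinearMap.trace R M (f ^ m) * LinearMap.trace R N (g ^ m) := by
  rw [TensorProduct.map_pow, LinearMap.trace_tensorProduct']

/-- **`exp(Σ_{m ≥ 1} tr(fᵐ) tr(gᵐ) Tᵐ/m) · det(1 − T·(f ⊗ g)) = 1`** in `R⟦T⟧`: Deligne's (1.5.3) for the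
endomorphism `f ⊗ g` of `M ⊗ N` («the ghost components of `det(1 − tφ|U)⁻¹` are `Trace(φⁿ|U)`»).
[cite: Ramachandran2014, §1] [cite: Deligne1974, (1.5.3)] -/
theorem exp_subst_mul_reverse_charpoly_map (f : M →ₗ[R] M) (g : N →ₗ[R] N) :
    (exp R).subst (PowerSeries.mk fun m => (m : ℚ)⁻¹ •
        (LinearMap.trace R M (f ^ m) * LinearMap.trace R N (g ^ m))) *
      ((TensorProduct.map f g).charpoly.reverse : R⟦X⟧) = 1 := by
  have h := exp_subst_endTraceLogSeries_mul_reverse_charpoly (TensorProduct.map f g)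
  have hs : (PowerSeries.mk fun m => (m : ℚ)⁻¹ • LinearMap.trace R (M ⊗[R] N) (TensorProduct.map f g ^ m)) =
      PowerSeries.mk fun m => (m : ℚ)⁻¹ • (LinearMap.trace R M (f ^ m) * LinearMap.trace R N (g ^ m)) := by
    ext m
    rw [coeff_mk, coeff_mk, trace_map_pow]
  rw [hs] at h
  exact h

omit [CharZero R] [Module.Finite R M] [Module.Finite R N] in
/-- `f ⊗ g` is invertible when `f` and `g` are. [folklore] -/
private theorem isUnit_map {f : M →ₗ[R] M} {g : N →ₗ[R] N} (hf : IsUnit f) (hg : IsUnit g) :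
    IsUnit (TensorProduct.map f g) := by
  obtain ⟨uf, rfl⟩ := hf
  obtain ⟨ug, rfl⟩ := hg
  refine isUnit_iff_exists.mpr ⟨TensorProduct.map (↑uf⁻¹ : M →ₗ[R] M) (↑ug⁻¹ : N →ₗ[R] N), ?_, ?_⟩
  · rw [← TensorProduct.map_mul, Units.mul_inv, Units.mul_inv, TensorProduct.map_one]
  · rw [← TensorProduct.map_mul, Units.inv_mul, Units.inv_mul, TensorProduct.map_one]

omit [CharZero R] in
/-- **`deg det(1 − T·(f ⊗ g)) = dim M · dim N`** for invertible `f`, `g` (the reverse of the characteristic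
polynomial of an invertible endomorphism has full degree; `dim (M ⊗ N) = dim M · dim N`).
[cite: Kahn2020, §3.6 (3.6.3) and axiom (vi)] -/
theorem natDegree_reverse_charpoly_map {f : M →ₗ[R] M} {g : N →ₗ[R] N} (hf : IsUnit f) (hg : IsUnit g) :
    (TensorProduct.map f g).charpoly.reverse.natDegree = Module.finrank R M * Module.finrank R N := by
  have h0 : (TensorProduct.map f g).charpoly.coeff 0 ≠ 0 := by
    intro h0
    have hdet := LinearMap.det_eq_sign_charpoly_coeff (TensorProduct.map f g)
    rw [h0, mul_zero] at hdet
    exact ((isUnit_map hf hg).map LinearMap.det).ne_zero hdet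
  rw [Literature.Algebra.Polynomial.ReciprocalPolynomialSplits.natDegree_reverse_of_coeff_zero_ne_zero h0,
    LinearMap.charpoly_natDegree, Module.finrank_tensorProduct]

end FrobeniusTrace

/-! ### §2 `Z(X ×ₖ Y, T)` through `⊕ Hⁱ(X) ⊗ Hʲ(Y)` -/

namespace GaloisWeilCohomology

open FrobeniusTrace
open CategoryTheory MonoidalCategory

variable {k : Type u} [Field k] [Finite k] {K : Type v} [Field K] [CharZero K]
  {χ : Field.absoluteGaloisGroup k →* Kˣ} (E : GaloisWeilCohomology k K χ)

/-- The Frobenius `F | Hⁱ(X)` is invertible (`F = ρ(geometric Frobenius)`, `ρ` a group action); private copy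
of the tree's `GaloisWeilCohomology.isUnit_frobAction` (`KatzMessingKunnethProjectors`, not imported here). [folklore] -/
private theorem frobAction_isUnit (X : SchemeOver k) (i : ℕ) : IsUnit (E.frobAction X i) := by
  rw [frobAction_def]
  exact (Group.isUnit (geomFrob k)).map (E.ρ X i)

/-- **`Z(X ×ₖ Y, T)` from the Künneth cohomology, without a Künneth axiom.**  Let `E` satisfy the Lefschetz
trace formula, `X` be smooth projective of dimension `n` and `Y` of dimension `n'`; write `Fᵢ = F | Hⁱ(X)`,
`F'ⱼ = F | Hʲ(Y)`.  Then in `K⟦T⟧`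
`Z(X ×ₖ Y, T) · ∏_{i ≤ 2n, j ≤ 2n', i+j even} det(1 − T·(Fᵢ ⊗ F'ⱼ) | Hⁱ(X) ⊗ Hʲ(Y)) =
 ∏_{i+j odd} det(1 − T·(Fᵢ ⊗ F'ⱼ) | Hⁱ(X) ⊗ Hʲ(Y))`:
the ghost components of both sides are `#(X ×ₖ Y)(𝔽_{q^m}) = #X(𝔽_{q^m}) #Y(𝔽_{q^m}) = Σ_{i,j} (−1)^{i+j}
tr(Fᵢᵐ) tr(F'ⱼᵐ) = Σ_{i,j} (−1)^{i+j} tr((Fᵢ ⊗ F'ⱼ)ᵐ)` (trace formula for `X` and for `Y` only).  With a Künneth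
isomorphism this is Deligne's (1.5.4) for `X ×ₖ Y`; here it holds for every `E` with the trace formula.
[cite: Ramachandran2014, Theorem 2.1 (i) (both proofs) and Remark 2.4] [cite: Deligne1974, (1.5.1)–(1.5.4)] -/
theorem zetaSeries_tensor_mul_prod_charpoly_tensor (hE : E.HasLefschetzTraceFormula) {n : ℕ} {X : SchemeOver k}
    (hX : IsSmoothProjective n X) {n' : ℕ} {Y : SchemeOver k} (hY : IsSmoothProjective n' Y) :
    (zetaSeries (X ⊗ Y)).map (algebraMap ℚ K) *
        ∏ p ∈ (Finset.range (2 * n + 1) ×ˢ Finset.range (2 * n' + 1)) with Even (p.1 + p.2),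
          (haveI := E.finite_obj hX p.1; haveI := E.finite_obj hY p.2;
            ((TensorProduct.map (E.frobAction X p.1) (E.frobAction Y p.2)).charpoly.reverse : PowerSeries K)) =
      ∏ p ∈ (Finset.range (2 * n + 1) ×ˢ Finset.range (2 * n' + 1)) with Odd (p.1 + p.2),
          (haveI := E.finite_obj hX p.1; haveI := E.finite_obj hY p.2;
            ((TensorProduct.map (E.frobAction X p.1) (E.frobAction Y p.2)).charpoly.reverse : PowerSeries K)) := by
  -- `L p = Σ_m tr(F_iᵐ) tr(F'_jᵐ) Tᵐ/m`
  set L : ℕ × ℕ → PowerSeries K := fun p =>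
    PowerSeries.mk fun m => (m : ℚ)⁻¹ • (E.frobTracePow X p.1 m * E.frobTracePow Y p.2 m) with hLdef
  have hL : ∀ p, constantCoeff (L p) = 0 := fun p => by
    rw [hLdef, ← coeff_zero_eq_constantCoeff_apply, coeff_mk, Nat.cast_zero, inv_zero, zero_smul]
  have hLn : ∀ p, constantCoeff (-L p) = 0 := fun p => by rw [map_neg, hL, neg_zero]
  -- each `det(1 − T·F_i ⊗ F'_j) = exp(−L p)`
  have hQ : ∀ p : ℕ × ℕ,
      (haveI := E.finite_obj hX p.1; haveI := E.finite_obj hY p.2;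
        ((TensorProduct.map (E.frobAction X p.1) (E.frobAction Y p.2)).charpoly.reverse : PowerSeries K)) =
        (PowerSeries.exp K).subst (-L p) := by
    intro p
    haveI := E.finite_obj hX p.1
    haveI := E.finite_obj hY p.2
    have h1 := exp_subst_mul_reverse_charpoly_map (E.frobAction X p.1) (E.frobAction Y p.2)
    have h1' : (PowerSeries.exp K).subst (L p) *
        ((TensorProduct.map (E.frobAction X p.1) (E.frobAction Y p.2)).charpoly.reverse : PowerSeries K) = 1 := by
      rw [hLdef]
      exact h1
    have h2 := exp_subst_mul_exp_subst_neg (hL p)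
    calc ((TensorProduct.map (E.frobAction X p.1) (E.frobAction Y p.2)).charpoly.reverse : PowerSeries K)
        = (PowerSeries.exp K).subst (L p) * (PowerSeries.exp K).subst (-L p) *
            ((TensorProduct.map (E.frobAction X p.1) (E.frobAction Y p.2)).charpoly.reverse : PowerSeries K) := by
          rw [h2, one_mul]
      _ = (PowerSeries.exp K).subst (-L p) * ((PowerSeries.exp K).subst (L p) *
            ((TensorProduct.map (E.frobAction X p.1) (E.frobAction Y p.2)).charpoly.reverse : PowerSeries K)) := by
          ring
      _ = (PowerSeries.exp K).subst (-L p) := by rw [h1', mul_one]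
  -- `Z(X × Y) = exp(log Z)` and `log Z(X × Y) = Σ_{i+j even} L − Σ_{i+j odd} L`
  have hZ : (zetaSeries (X ⊗ Y)).map (algebraMap ℚ K) =
      (PowerSeries.exp K).subst ((logZetaSeries (X ⊗ Y)).map (algebraMap ℚ K)) := by
    have h := PowerSeries.map_subst (hasSubst_logZetaSeries (X ⊗ Y)) (h := algebraMap ℚ K) (PowerSeries.exp ℚ)
    rw [map_exp] at h
    exact h
  set S := Finset.range (2 * n + 1) ×ˢ Finset.range (2 * n' + 1) with hS_def
  have hlog : (logZetaSeries (X ⊗ Y)).map (algebraMap ℚ K) =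
      ∑ p ∈ S with Even (p.1 + p.2), L p - ∑ p ∈ S with Odd (p.1 + p.2), L p := by
    have hsigned : (logZetaSeries (X ⊗ Y)).map (algebraMap ℚ K) = ∑ p ∈ S, PowerSeries.C ((-1 : K) ^ (p.1 + p.2)) * L p := by
      ext m
      simp only [coeff_map, coeff_logZetaSeries, map_sum, coeff_C_mul, hLdef, coeff_mk, Rat.smul_def, Rat.cast_inv,
        Rat.cast_natCast]
      split_ifs with hm
      · simp [hm]
      · rw [map_div₀, map_natCast, map_natCast, pointCount_tensorObj, Nat.cast_mul,
          hE hX m (Nat.pos_of_ne_zero hm), hE hY m (Nat.pos_of_ne_zero hm), Finset.sum_mul_sum,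
          ← Finset.sum_product', Finset.sum_div]
        refine Finset.sum_congr rfl fun p _ => ?_
        rw [pow_add]
        ring
    rw [hsigned, ← Finset.sum_filter_add_sum_filter_not S (fun p : ℕ × ℕ => Even (p.1 + p.2)), sub_eq_add_neg,
      ← Finset.sum_neg_distrib]
    congr 1
    · exact Finset.sum_congr rfl fun p hp => by rw [(Finset.mem_filter.mp hp).2.neg_one_pow, map_one, one_mul]
    · refine Finset.sum_congr (Finset.filter_congr fun p _ => Nat.not_even_iff_odd) fun p hp => ?_
      rw [(Finset.mem_filter.mp hp).2.neg_one_pow, map_neg, map_one, neg_one_mul]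
  have hprod : ∀ (P : ℕ × ℕ → Prop) [DecidablePred P],
      ∏ p ∈ S with P p, (haveI := E.finite_obj hX p.1; haveI := E.finite_obj hY p.2;
          ((TensorProduct.map (E.frobAction X p.1) (E.frobAction Y p.2)).charpoly.reverse : PowerSeries K)) =
        (PowerSeries.exp K).subst (-∑ p ∈ S with P p, L p) := by
    intro P _
    rw [← Finset.sum_neg_distrib, exp_subst_sum _ _ fun p _ => hLn p]
    exact Finset.prod_congr rfl fun p _ => hQ p
  have hev : constantCoeff (∑ p ∈ S with Even (p.1 + p.2), L p - ∑ p ∈ S with Odd (p.1 + p.2), L p) = 0 := by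
    rw [map_sub, map_sum, map_sum, Finset.sum_eq_zero fun p _ => hL p, Finset.sum_eq_zero fun p _ => hL p, sub_zero]
  have hev' : constantCoeff (-∑ p ∈ S with Even (p.1 + p.2), L p) = 0 := by
    rw [map_neg, map_sum, Finset.sum_eq_zero fun p _ => hL p, neg_zero]
  rw [hZ, hlog, hprod, hprod, ← exp_subst_add hev hev']
  congr 1
  ring

/-! ### §3 The Euler characteristic of a product, unconditionally -/

/-- A polynomial with constant coefficient `1` is non-zero, as is its image in `K⟦T⟧`'s coefficient ring. [folklore] -/
private theorem ne_zero_of_coeff_zero_eq_one {P : K[X]} (h : P.coeff 0 = 1) : P ≠ 0 := fun h' => by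
  rw [h', Polynomial.coeff_zero] at h
  exact zero_ne_one h

/-- **`e(X ×ₖ Y) = e(X) · e(Y)` from the trace formula alone**: for `E` with the Lefschetz trace formula and
`X`, `Y` smooth projective of dimensions `n`, `n'`,
`Σ_{κ ≤ 2(n+n')} (−1)^κ b_κ(X ×ₖ Y) = (Σ_{i ≤ 2n} (−1)ⁱ bᵢ(X)) · (Σ_{j ≤ 2n'} (−1)ʲ bⱼ(Y))` with `b = dim_K H`
(no Riemann hypothesis, no Künneth axiom): `Z(X ×ₖ Y)` is both `∏ P_κ(X × Y)^{(−1)^{κ+1}}` (Deligne (1.5.4)) and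
`∏ det(1 − T·Fᵢ ⊗ F'ⱼ)^{(−1)^{i+j+1}}` (`zetaSeries_tensor_mul_prod_charpoly_tensor`); compare the degrees
`deg P_κ = b_κ`, `deg det(1 − T·Fᵢ ⊗ F'ⱼ) = bᵢbⱼ` of the cross-multiplied polynomial identity.
[cite: Gottsche1993, §1.2 p. 6 and Theorem 1.2.1 (4)] [cite: Kahn2020, §3.6 (3.6.3) and axiom (vi)] [cite: Ramachandran2014, Theorem 2.1 (i)] -/
theorem sum_neg_one_pow_mul_finrank_tensor_eq_mul (hE : E.HasLefschetzTraceFormula) {n : ℕ} {X : SchemeOver k}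
    (hX : IsSmoothProjective n X) {n' : ℕ} {Y : SchemeOver k} (hY : IsSmoothProjective n' Y) :
    ∑ κ ∈ Finset.range (2 * (n + n') + 1), (-1 : ℤ) ^ κ * Module.finrank K (E.obj (X ⊗ Y) κ) =
      (∑ i ∈ Finset.range (2 * n + 1), (-1 : ℤ) ^ i * Module.finrank K (E.obj X i)) *
        ∑ j ∈ Finset.range (2 * n' + 1), (-1 : ℤ) ^ j * Module.finrank K (E.obj Y j) := by
  classical
  have hXY : IsSmoothProjective (n + n') (X ⊗ Y) := IsSmoothProjective.tensor_holds hX hY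
  set S := Finset.range (2 * n + 1) ×ˢ Finset.range (2 * n' + 1) with hS_def
  -- the two polynomial families
  set A : ℕ → K[X] := fun κ => E.frobCharPoly (X ⊗ Y) κ with hA_def
  set B : ℕ × ℕ → K[X] := fun p =>
    (haveI := E.finite_obj hX p.1; haveI := E.finite_obj hY p.2;
      (TensorProduct.map (E.frobAction X p.1) (E.frobAction Y p.2)).charpoly.reverse) with hB_def
  have hA0 : ∀ κ, (A κ).coeff 0 = 1 := fun κ => E.coeff_zero_frobCharPoly (X ⊗ Y) κ
  have hB0 : ∀ p, (B p).coeff 0 = 1 := fun p => by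
    haveI := E.finite_obj hX p.1
    haveI := E.finite_obj hY p.2
    rw [hB_def]
    dsimp only
    rw [Polynomial.coeff_zero_reverse, (LinearMap.charpoly_monic _).leadingCoeff]
  have hAdeg : ∀ κ, (A κ).natDegree = Module.finrank K (E.obj (X ⊗ Y) κ) := fun κ =>
    E.natDegree_frobCharPoly_eq hXY κ
  have hBdeg : ∀ p : ℕ × ℕ, (B p).natDegree = Module.finrank K (E.obj X p.1) * Module.finrank K (E.obj Y p.2) := by
    intro p
    haveI := E.finite_obj hX p.1
    haveI := E.finite_obj hY p.2
    rw [hB_def]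
    exact natDegree_reverse_charpoly_map (E.frobAction_isUnit X p.1) (E.frobAction_isUnit Y p.2)
  -- the two expressions of `Z(X × Y)`
  have h1 := E.zetaSeries_mul_prod_frobCharPoly_holds hE hXY
  have h2 := E.zetaSeries_tensor_mul_prod_charpoly_tensor hE hX hY
  set Z := (zetaSeries (X ⊗ Y)).map (algebraMap ℚ K) with hZ_def
  set Ae := ∏ κ ∈ (Finset.range (2 * (n + n') + 1)) with Even κ, A κ with hAe_def
  set Ao := ∏ κ ∈ (Finset.range (2 * (n + n') + 1)) with Odd κ, A κ with hAo_def
  set Be := ∏ p ∈ S with Even (p.1 + p.2), B p with hBe_def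
  set Bo := ∏ p ∈ S with Odd (p.1 + p.2), B p with hBo_def
  have hcoe : ∀ {ι : Type} (s : Finset ι) (f : ι → K[X]),
      ((∏ i ∈ s, f i : K[X]) : PowerSeries K) = ∏ i ∈ s, (f i : PowerSeries K) := by
    intro ι s f
    rw [← Polynomial.coeToPowerSeries.ringHom_apply, map_prod]
    rfl
  have h1' : Z * (Ae : PowerSeries K) = (Ao : PowerSeries K) := by
    rw [hAe_def, hAo_def, hcoe, hcoe]
    exact h1
  have h2' : Z * (Be : PowerSeries K) = (Bo : PowerSeries K) := by
    rw [hBe_def, hBo_def, hcoe, hcoe]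
    exact h2
  -- cross-multiplied: `Ao · Be = Bo · Ae` as polynomials
  have hcross : Ao * Be = Bo * Ae := by
    have h : ((Ao * Be : K[X]) : PowerSeries K) = ((Bo * Ae : K[X]) : PowerSeries K) := by
      rw [Polynomial.coe_mul, Polynomial.coe_mul, ← h1', ← h2']
      ring
    exact Polynomial.coe_inj.mp h
  have hAne : ∀ κ, A κ ≠ 0 := fun κ => ne_zero_of_coeff_zero_eq_one (hA0 κ)
  have hBne : ∀ p, B p ≠ 0 := fun p => ne_zero_of_coeff_zero_eq_one (hB0 p)
  have hAe0 : Ae ≠ 0 := Finset.prod_ne_zero_iff.mpr fun κ _ => hAne κ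
  have hAo0 : Ao ≠ 0 := Finset.prod_ne_zero_iff.mpr fun κ _ => hAne κ
  have hBe0 : Be ≠ 0 := Finset.prod_ne_zero_iff.mpr fun p _ => hBne p
  have hBo0 : Bo ≠ 0 := Finset.prod_ne_zero_iff.mpr fun p _ => hBne p
  have hdeg := congrArg Polynomial.natDegree hcross
  rw [Polynomial.natDegree_mul hAo0 hBe0, Polynomial.natDegree_mul hBo0 hAe0, hAo_def, hBe_def, hBo_def, hAe_def,
    Polynomial.natDegree_prod _ _ (fun κ _ => hAne κ), Polynomial.natDegree_prod _ _ (fun p _ => hBne p),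
    Polynomial.natDegree_prod _ _ (fun p _ => hBne p), Polynomial.natDegree_prod _ _ (fun κ _ => hAne κ)] at hdeg
  simp only [hAdeg, hBdeg] at hdeg
  -- `Σ_even b_κ − Σ_odd b_κ = Σ_{i+j even} bᵢbⱼ − Σ_{i+j odd} bᵢbⱼ`
  have hdegZ : (∑ κ ∈ (Finset.range (2 * (n + n') + 1)) with Even κ, (Module.finrank K (E.obj (X ⊗ Y) κ) : ℤ)) -
      ∑ κ ∈ (Finset.range (2 * (n + n') + 1)) with Odd κ, (Module.finrank K (E.obj (X ⊗ Y) κ) : ℤ) =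
      (∑ p ∈ S with Even (p.1 + p.2), ((Module.finrank K (E.obj X p.1) * Module.finrank K (E.obj Y p.2) : ℕ) : ℤ)) -
        ∑ p ∈ S with Odd (p.1 + p.2), ((Module.finrank K (E.obj X p.1) * Module.finrank K (E.obj Y p.2) : ℕ) : ℤ) := by
    have h := congrArg (fun t : ℕ => (t : ℤ)) hdeg
    push_cast at h ⊢
    linarith
  -- signed sums as differences of the even and odd parts
  have hsignedA : ∑ κ ∈ Finset.range (2 * (n + n') + 1), (-1 : ℤ) ^ κ * Module.finrank K (E.obj (X ⊗ Y) κ) =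
      (∑ κ ∈ (Finset.range (2 * (n + n') + 1)) with Even κ, (Module.finrank K (E.obj (X ⊗ Y) κ) : ℤ)) -
        ∑ κ ∈ (Finset.range (2 * (n + n') + 1)) with Odd κ, (Module.finrank K (E.obj (X ⊗ Y) κ) : ℤ) := by
    rw [← Finset.sum_filter_add_sum_filter_not (Finset.range (2 * (n + n') + 1)) (fun κ => Even κ), sub_eq_add_neg,
      ← Finset.sum_neg_distrib]
    congr 1
    · exact Finset.sum_congr rfl fun κ hκ => by rw [(Finset.mem_filter.mp hκ).2.neg_one_pow, one_mul]
    · refine Finset.sum_congr (Finset.filter_congr fun κ _ => Nat.not_even_iff_odd) fun κ hκ => ?_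
      rw [(Finset.mem_filter.mp hκ).2.neg_one_pow, neg_one_mul]
  have hsignedB : (∑ i ∈ Finset.range (2 * n + 1), (-1 : ℤ) ^ i * Module.finrank K (E.obj X i)) *
      ∑ j ∈ Finset.range (2 * n' + 1), (-1 : ℤ) ^ j * Module.finrank K (E.obj Y j) =
      (∑ p ∈ S with Even (p.1 + p.2), ((Module.finrank K (E.obj X p.1) * Module.finrank K (E.obj Y p.2) : ℕ) : ℤ)) -
        ∑ p ∈ S with Odd (p.1 + p.2), ((Module.finrank K (E.obj X p.1) * Module.finrank K (E.obj Y p.2) : ℕ) : ℤ) := by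
    rw [Finset.sum_mul_sum, ← Finset.sum_product', ← hS_def,
      ← Finset.sum_filter_add_sum_filter_not S (fun p : ℕ × ℕ => Even (p.1 + p.2)), sub_eq_add_neg,
      ← Finset.sum_neg_distrib]
    congr 1
    · refine Finset.sum_congr rfl fun p hp => ?_
      rw [mul_mul_mul_comm, ← pow_add, (Finset.mem_filter.mp hp).2.neg_one_pow, one_mul, Nat.cast_mul]
    · refine Finset.sum_congr (Finset.filter_congr fun p _ => Nat.not_even_iff_odd) fun p hp => ?_
      rw [mul_mul_mul_comm, ← pow_add, (Finset.mem_filter.mp hp).2.neg_one_pow, neg_one_mul, Nat.cast_mul]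
  rw [hsignedA, hsignedB, hdegZ]

end GaloisWeilCohomology

end Literature.AlgebraicGeometry.Motives
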